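import Mathlib.Analysis.SpecialFunctions.Trigonometric.Deriv
import Mathlib.Analysis.SpecialFunctions.ExpDeriv
import Mathlib.Analysis.Calculus.Gradient.Basic
import Mathlib.Analysis.InnerProductSpace.Adjoint
import Mathlib.Analysis.InnerProductSpace.Calculus
import Literature.Analysis.PDE.LoewnerNirenbergFactsProofs
import HarnessLib

/-!
# Scalar Kelvin modes: exact solutions of advection–diffusion by an affine flow

Analysis/FluidPDE proofs-layer file (theorems + one data definition, NO `Prop` facts), the PASSIVE
SCALAR companion of `KelvinModeLinearFlow` (Kelvin modes on linear flows are exact Navier–Stokes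
solutions, Craik–Criminale 1986). On a finite-dimensional real inner-product space `E` consider the
advection–diffusion equation `∂ₜθ + (A(t)x + b(t))·∇θ = κΔθ` with an AFFINE, time-dependent velocity.
The scalar Kelvin mode

`θ(t, x) = c(t) cos(⟪k(t), x⟫ + φ(t))` (`KelvinMode.scalarMode`)

solves it EXACTLY as soon as the phase is frozen into the flow and the amplitude decays by diffusion:

`k̇ = −A(t)† k`, `φ̇ = −⟪k, b(t)⟫`, `ċ = −κ‖k‖² c`

(`KelvinMode.scalarMode_transport`) — Fabijonas–Holm 2004, §2: the phase `Φ = k(t)·x + δ(t)` obeys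
`(∂ₜ + U·∇)Φ = 0`, i.e. `k̇ = −Lᵀ k`, `δ̇ = −C·k` for `U = L(t)x + C(t)`, and viscosity contributes the
factor `exp(−ν∫|k|²)`; Craik–Criminale 1986 / Drazin 2002 Ex. 2.19 (`f = g(k·x − ωt)` on `U = S(t)x + U₀(t)`).
Also here: `∇θ = −c sin(⟪k,x⟫ + φ) k`, `Δθ = −‖k‖² θ`, the explicit amplitude `c = c₀ exp(−κK)` for a
primitive `K̇ = ‖k‖²` (`hasDerivWithinAt_expAmplitude`), and the PLANAR SHEAR instance (`shearGen`,
`adjoint_shearGen`, `hasDerivWithinAt_shearWavevector`): for `u = (a(t) s x₂, 0) + b(t)` the wavevector is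
`k(t) = k₀ − s Λ(t) k₀,₁ e₂` with `Λ̇ = a` (Orr's tilting mechanism). Motivation (cell `ad-ideate`, seat
ad-p2, K3′/S3 "cells" line): off its corner strips the sawtooth shear of `SawtoothCascade` is affine, so each
pulse acts on Fourier modes by this explicit map. These are statements on the whole space `E`
(infinite-extent modes); localisation to a cell of `𝕋²` is the user's business.

## Mathlib / tree search

Tree: `KelvinModeLinearFlow` (vector/NS version; `wave`, `laplacian_wave`), reused
`Literature.Analysis.PDE.LoewnerNirenberg.laplacian_comp_inner` (`Δ(g ∘ ⟪ν,·⟫) = g'' ‖ν‖²`); `lean search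
'scalarMode|advection.*affine|Kelvin.*scalar'`: nothing scalar. Mathlib: `hasGradientAt_iff_hasFDerivAt`,
`ContinuousLinearMap.adjoint_inner_left`, `Real.hasDerivAt_cos`, `HasDerivWithinAt.inner`.

## References

* B. R. Fabijonas, D. D. Holm, J. Fluid Mech. 506 (2004) 207–215, §2 [held: arXiv:nlin/0304049].
  [`FabijonasHolm2004`]
* A. D. D. Craik, W. O. Criminale, Proc. R. Soc. Lond. A 406 (1986) 13–26. [`CraikCriminale1986`]
* P. G. Drazin, *Introduction to Hydrodynamic Stability*, CUP 2002, Ex. 2.19 [held]. [`Drazin2002`]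
-/

noncomputable section

open Set Function InnerProductSpace
open scoped Laplacian InnerProductSpace RealInnerProductSpace InnerProduct Topology

namespace Literature.Analysis.FluidPDE

namespace KelvinMode

variable {E : Type*} [NormedAddCommGroup E] [InnerProductSpace ℝ E] [FiniteDimensional ℝ E]

/-! ### §1 The scalar mode and its spatial calculus -/

/-- The scalar Kelvin mode with wavevector path `k`, amplitude `c` and phase `φ`:
`θ(t, x) = c(t) cos(⟪k(t), x⟫ + φ(t))` (the real part of `c e^{i(k·x + φ)}`).
[cite: FabijonasHolm2004, §2 (disturbance a(t) e^{iΦ}, Φ = k(t)·x + δ(t))] -/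
def scalarMode (k : ℝ → E) (c φ : ℝ → ℝ) (t : ℝ) (x : E) : ℝ :=
  c t * Real.cos (⟪k t, x⟫ + φ t)

omit [FiniteDimensional ℝ E] in
/-- Unfolding the scalar mode. [cite: FabijonasHolm2004, §2 (Φ = k(t)·x + δ(t))] -/
theorem scalarMode_apply (k : ℝ → E) (c φ : ℝ → ℝ) (t : ℝ) (x : E) :
    scalarMode k c φ t x = c t * Real.cos (⟪k t, x⟫ + φ t) :=
  rfl

/-- **`∇θ = −c sin(⟪k,x⟫ + φ) k`.** [cite: FabijonasHolm2004, §2 (∇Φ = k)] -/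
theorem hasGradientAt_scalarMode (k : ℝ → E) (c φ : ℝ → ℝ) (t : ℝ) (x : E) :
    HasGradientAt (scalarMode k c φ t) ((-(c t * Real.sin (⟪k t, x⟫ + φ t))) • k t) x := by
  rw [hasGradientAt_iff_hasFDerivAt]
  have h1 : HasFDerivAt (fun y : E => ⟪k t, y⟫ + φ t) (innerSL ℝ (k t) : E →L[ℝ] ℝ) x :=
    ((innerSL ℝ (k t) : E →L[ℝ] ℝ).hasFDerivAt).add_const (φ t)
  have h2 := ((Real.hasDerivAt_cos _).comp_hasFDerivAt x h1).const_mul (c t)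
  refine h2.congr_fderiv ?_
  ext v
  simp only [FunLike.coe_smul, Pi.smul_apply, innerSL_apply_apply, smul_eq_mul,
    InnerProductSpace.toDual_apply_apply, real_inner_smul_left]
  ring

/-- The gradient of the scalar mode. [cite: FabijonasHolm2004, §2 (∇Φ = k)] -/
theorem gradient_scalarMode (k : ℝ → E) (c φ : ℝ → ℝ) (t : ℝ) (x : E) :
    gradient (scalarMode k c φ t) x = (-(c t * Real.sin (⟪k t, x⟫ + φ t))) • k t :=
  (hasGradientAt_scalarMode k c φ t x).gradient

/-- **`Δθ = −‖k‖² θ`**: the scalar mode is an eigenfunction of the Laplacian.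
[cite: FabijonasHolm2004, §2 (viscous term −ν m²β²|∇Φ|² a_m)] -/
theorem laplacian_scalarMode (k : ℝ → E) (c φ : ℝ → ℝ) (t : ℝ) (x : E) :
    Δ (scalarMode k c φ t) x = -(‖k t‖ ^ 2) * scalarMode k c φ t x := by
  have hg : ∀ σ ∈ (univ : Set ℝ), HasDerivAt (fun σ => c t * Real.cos (σ + φ t))
      (-(c t * Real.sin (σ + φ t))) σ := fun σ _ => by
    have h1 : HasDerivAt (fun σ => σ + φ t) 1 σ := (hasDerivAt_id σ).add_const (φ t)
    have h2 : HasDerivAt (fun σ => Real.cos (σ + φ t)) (-Real.sin (σ + φ t) * 1) σ :=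
      (Real.hasDerivAt_cos _).comp σ h1
    exact (h2.const_mul (c t)).congr_deriv (by ring)
  have hg₁ : HasDerivAt (fun σ => -(c t * Real.sin (σ + φ t))) (-(c t * Real.cos (⟪k t, x⟫ + φ t)))
      ⟪k t, x⟫ := by
    have h1 : HasDerivAt (fun σ => σ + φ t) 1 ⟪k t, x⟫ := (hasDerivAt_id _).add_const (φ t)
    have h2 : HasDerivAt (fun σ => Real.sin (σ + φ t)) (Real.cos (⟪k t, x⟫ + φ t) * 1) ⟪k t, x⟫ :=
      (Real.hasDerivAt_sin _).comp ⟪k t, x⟫ h1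
    exact ((h2.const_mul (c t)).neg).congr_deriv (by ring)
  have h := Literature.Analysis.PDE.LoewnerNirenberg.laplacian_comp_inner isOpen_univ hg (k t)
    (mem_univ _) hg₁
  change Δ (fun w : E => c t * Real.cos (⟪k t, w⟫ + φ t)) x = _
  rw [h, scalarMode]
  ring

/-! ### §2 The time derivative and the transport identity -/

omit [FiniteDimensional ℝ E] in
/-- Time derivative of the scalar mode at a fixed point, for wavevector, amplitude and phase
differentiable within a time set `S`. [cite: FabijonasHolm2004, §2 ((∂ₜ + U·∇)Φ = 0)] -/
theorem hasDerivWithinAt_scalarMode_apply {S : Set ℝ} {t : ℝ} {k : ℝ → E} {c φ : ℝ → ℝ}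
    {k' : E} {c' φ' : ℝ} (x : E) (hk : HasDerivWithinAt k k' S t)
    (hc : HasDerivWithinAt c c' S t) (hφ : HasDerivWithinAt φ φ' S t) :
    HasDerivWithinAt (fun s => scalarMode k c φ s x)
      (c' * Real.cos (⟪k t, x⟫ + φ t) +
        c t * (-Real.sin (⟪k t, x⟫ + φ t) * (⟪k', x⟫ + φ'))) S t := by
  have hψ : HasDerivWithinAt (fun s => ⟪k s, x⟫ + φ s) (⟪k', x⟫ + φ') S t := by
    have h := hk.inner ℝ (hasDerivWithinAt_const t S x)
    simp only [inner_zero_right, zero_add] at h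
    exact h.add hφ
  have hcos := (Real.hasDerivAt_cos _).comp_hasDerivWithinAt t hψ
  exact hc.mul hcos

/-- **Scalar Kelvin modes solve advection–diffusion by an affine flow exactly.** Let
`u(t, x) = A(t) x + b(t)` with `A(t) : E →L[ℝ] E`. If on the time set `S` (with unique derivatives,
e.g. an interval) the wavevector is frozen into the flow, `k̇ = −A(t)† k`, the phase follows the
drift, `φ̇ = −⟪k, b(t)⟫`, and the amplitude decays by diffusion, `ċ = −κ‖k‖² c`, then
`θ = c cos(⟪k, x⟫ + φ)` satisfies `∂ₜθ + ⟪A(t)x + b(t), ∇θ⟫ = κ Δθ` at `(t, x)` for every `x ∈ E`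
(one-sided/within-`S` time derivative). No condition on `A` (incompressibility, `trace A = 0`, is not
needed for the scalar identity). [cite: FabijonasHolm2004, §2 (k̇ = −Lᵀk, δ̇ = −C·k, factor exp(−ν∫|k|²)); CraikCriminale1986, §2; Drazin2002, Ex. 2.19] -/
theorem scalarMode_transport {S : Set ℝ} (hS : UniqueDiffOn ℝ S) {κ : ℝ} {A : ℝ → (E →L[ℝ] E)}
    {b k : ℝ → E} {c φ : ℝ → ℝ} {t : ℝ} (ht : t ∈ S)
    (hk : HasDerivWithinAt k (-(((A t)†) (k t))) S t)
    (hc : HasDerivWithinAt c (-(κ * ‖k t‖ ^ 2 * c t)) S t)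
    (hφ : HasDerivWithinAt φ (-⟪k t, b t⟫) S t) (x : E) :
    derivWithin (fun s => scalarMode k c φ s x) S t +
        ⟪A t x + b t, gradient (scalarMode k c φ t) x⟫ =
      κ * Δ (scalarMode k c φ t) x := by
  rw [(hasDerivWithinAt_scalarMode_apply x hk hc hφ).derivWithin (hS t ht),
    gradient_scalarMode, laplacian_scalarMode, real_inner_smul_right, inner_add_left,
    inner_neg_left, ContinuousLinearMap.adjoint_inner_left, real_inner_comm (b t) (k t),
    real_inner_comm ((A t) x) (k t), scalarMode]
  ring

omit [InnerProductSpace ℝ E] [FiniteDimensional ℝ E] in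
/-- **The explicit amplitude.** If `K̇ = ‖k‖²` within `S` at `t`, then `c = c₀ exp(−κK)` has
`ċ = −κ‖k‖² c` there (so `c(t) = c₀ exp(−κ ∫ ‖k‖²)` is the diffusive damping of the mode).
[cite: FabijonasHolm2004, §2 (a = ã exp(−∫₀ᵗ ν m²β²|k(τ)|² dτ))] -/
theorem hasDerivWithinAt_expAmplitude {S : Set ℝ} {t : ℝ} {k : ℝ → E} {K : ℝ → ℝ}
    (hK : HasDerivWithinAt K (‖k t‖ ^ 2) S t) (c₀ κ : ℝ) :
    HasDerivWithinAt (fun s => c₀ * Real.exp (-(κ * K s)))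
      (-(κ * ‖k t‖ ^ 2 * (c₀ * Real.exp (-(κ * K t))))) S t := by
  have h1 : HasDerivWithinAt (fun s => -(κ * K s)) (-(κ * ‖k t‖ ^ 2)) S t := (hK.const_mul κ).neg
  exact ((h1.exp).const_mul c₀).congr_deriv (by ring)

/-! ### §3 The planar shear instance (Orr tilting) -/

/-- The generator of the planar shear `x ↦ (s x₂, 0)` on `ℝ²`: `shearGen s x = (s · x 1) e₀`.
[cite: Drazin2002, Ex. 2.19 (U = S(t)x + U₀(t))] -/
def shearGen (s : ℝ) : EuclideanSpace ℝ (Fin 2) →L[ℝ] EuclideanSpace ℝ (Fin 2) :=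
  (s • (EuclideanSpace.proj 1 : EuclideanSpace ℝ (Fin 2) →L[ℝ] ℝ)).smulRight
    (EuclideanSpace.single 0 (1 : ℝ))

/-- `shearGen s x = (s x₁) • e₀`. [cite: Drazin2002, Ex. 2.19 (U = S(t)x + U₀(t))] -/
@[simp] theorem shearGen_apply (s : ℝ) (x : EuclideanSpace ℝ (Fin 2)) :
    shearGen s x = (s * x 1) • EuclideanSpace.single 0 (1 : ℝ) := by
  simp [shearGen, smul_eq_mul]

/-- **Adjoint of the shear generator**: `(shearGen s)† k = (s k₀) • e₁` (the transpose of `e₀ ⊗ e₁`).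
[cite: FabijonasHolm2004, §2 (the operator Lᵀ)] -/
theorem adjoint_shearGen_apply (s : ℝ) (k : EuclideanSpace ℝ (Fin 2)) :
    ((shearGen s)†) k = (s * k 0) • EuclideanSpace.single 1 (1 : ℝ) := by
  refine ext_inner_right ℝ fun v => ?_
  rw [ContinuousLinearMap.adjoint_inner_left, shearGen_apply, real_inner_smul_right,
    real_inner_smul_left, EuclideanSpace.inner_single_right, EuclideanSpace.inner_single_left]
  simp only [map_one, one_mul, conj_trivial]
  ring

/-- **The shear wavevector (Orr's mechanism).** Along the planar shear `u(t, x) = (a(t) s x₂, 0) + b(t)`,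
i.e. `A(t) = shearGen (a(t) s)`, the frozen wavevector is `k(t) = k₀ − (s Λ(t) k₀,₀) e₁` for any
primitive `Λ̇ = a`: it solves `k̇ = −A(t)† k` (the streamwise wavenumber `k₀,₀` is conserved, the
cross-stream one is tilted at rate `−a s k₀,₀`). [cite: FabijonasHolm2004, §2 (k̇ = −Lᵀk); Drazin2002, Ex. 2.19] -/
theorem hasDerivWithinAt_shearWavevector {S : Set ℝ} {t : ℝ} {Λ : ℝ → ℝ} {a : ℝ}
    (hΛ : HasDerivWithinAt Λ a S t) (s : ℝ) (k₀ : EuclideanSpace ℝ (Fin 2)) :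
    HasDerivWithinAt (fun τ => k₀ - (s * Λ τ * k₀ 0) • EuclideanSpace.single 1 (1 : ℝ))
      (-(((shearGen (a * s))†) (k₀ - (s * Λ t * k₀ 0) • EuclideanSpace.single 1 (1 : ℝ)))) S t := by
  rw [adjoint_shearGen_apply]
  have hcoef : HasDerivWithinAt (fun τ => s * Λ τ * k₀ 0) (s * a * k₀ 0) S t :=
    (hΛ.const_mul s).mul_const (k₀ 0)
  have h := (hcoef.smul_const (EuclideanSpace.single 1 (1 : ℝ))).const_sub k₀
  refine h.congr_deriv ?_
  have h0 : (k₀ - (s * Λ t * k₀ 0) • EuclideanSpace.single 1 (1 : ℝ) : EuclideanSpace ℝ (Fin 2)) 0 =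
      k₀ 0 := by
    simp
  rw [h0]
  simp only [neg_inj]
  congr 1
  ring

end KelvinMode

end Literature.Analysis.FluidPDE

end
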